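import Literature.NumberTheory.Automorphic.Liu2021.LemD1DataOfPlaceIsometric
import Literature.NumberTheory.GelbartRogawski1991.LocalSplittingUnitary
import HarnessLib

/-!
# [Liu2021, App. D Lem. D.1 (1)] at a finite place: the reading at the tree's CM family of local splittings is the
# reading at ANY unitary family — unconditionally, at every place

Topic `NumberTheory/Automorphic/Liu2021`; namespace `Literature.NumberTheory.Automorphic.Liu2021.LemD1OfPlace`.  KERNEL
ONLY: theorems; no definition, no named fact, no `sorry`.  Nothing of [Liu2021] is asserted.

`LemD1DataOfPlaceIsometric.lean`: two families of local splittings whose local Weil representations at `v` are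
`L²`-isometric give the same reading of Lemma D.1 (first sentence + (1)) AS PRINTED over all Step-3 characters
(`N ≠ 2`).  `GelbartRogawski1991/LocalSplittingUnitary.lean`: the tree's CM family
`finLocalSplittingsCM L n hT₀ hT₀d hJ χ hχ` (the cite-free [GelbartRogawski1991, Prop. 3.1.1] construction: Kudla's
splitting of the doubled group, undoubled) IS `L²`-isometric at every finite place when the splitting character `χ` is
unitary.  Hence:

* **`forall_lemD1_1AsPrinted_iff_finLocalSplittingsCM`** — for EVERY finite place `v` of `L⁺`, every Haar measure `μ'`
  on `L⁺_v`, and every family `𝓢'` of local splittings of `U(J)(L⁺_v)` whose local Weil representation at `v` is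
  `L²(μ'ⁿ)`-isometric (e.g. [Liu2021]'s own `ω(ε) ∘ ι_μ`, [HarrisKudlaSweet1996, §1]: a unitary representation):
  `(∀ χ', LemD1_1AsPrinted (data (𝓢_CM.omegaLoc v) μ_v χ')) ↔ (∀ χ', LemD1_1AsPrinted (data (𝓢'.omegaLoc v) μ_v χ'))`.

For the Hodge/COR-CM cell (`n = 3`, `𝓢 = muLocalSplittings = finLocalSplittingsCM … (chiMu …)`, `χ = chiMu` unitary):
the per-place cite `hD1` read at the tree's family does not depend on the choice of (unitary) local splittings at
ANY place — the normalisation part of the object-match duty (om1) is discharged in the kernel; what remains is the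
identification of the tree's Schrödinger model and metaplectic cover of `Sp(Res_{E/F} V)` with [Liu2021]'s
`(Mp(V_ε), ω(ε))`.

## References
* [Liu2021] Y. Liu, Camb. J. Math. 9 (2021) = arXiv:2102.11518, App. D §D.1, Lem. D.1 (l. 5226–5229).
* [GelbartRogawski1991] S. Gelbart, J. Rogawski, Invent. Math. 105 (1991), §3.1 Prop. 3.1.1, Remark p. 457.
* [HarrisKudlaSweet1996] M. Harris, S. S. Kudla, W. J. Sweet, JAMS 9 (1996), §1.
* [Weil1964] A. Weil, Acta Math. 111 (1964), Chap. I n° 13.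
-/

set_option autoImplicit false

noncomputable section

open scoped Matrix
open NumberField IsDedekindDomain _root_.MeasureTheory
open Literature.NumberTheory.GelbartRogawski1991.UnitaryDualPair
open Literature.NumberTheory.GelbartRogawski1991.UnitaryDualPair.LocalSplitting
open Literature.NumberTheory.GaloisRepresentations Literature.RepresentationTheory.HarrisKudlaSweet1996

namespace Literature.NumberTheory.Automorphic.Liu2021.LemD1OfPlace

open UnitaryGroup

variable (L : Type) [Field L] [NumberField L] [IsCMField L] (n : ℕ) {T₀ : Matrix (Fin n) (Fin n) (maximalRealSubfield L)}
  (hT₀ : T₀.IsSymm) (hT₀d : IsUnit T₀.det) {J : Matrix (Fin n) (Fin n) L}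
  (hJ : J = T₀.map (algebraMap (maximalRealSubfield L) L)) (χ : HeckeCharacter L) (hχ : IsSplittingChar L 1 χ)
  (v : HeightOneSpectrum (𝓞 (maximalRealSubfield L)))
  (hN : 2 ≤ n) (hJh : (J.map (IsCMField.complexConj L))ᵀ = J) (hJdet : J.det ≠ 0)
  (J₁ : Matrix (Fin 1) (Fin 1) L) (hJ₁ : J₁ 0 0 ≠ 0)
  (μ : (LocalRing L v)ˣ →* ℂˣ) (hμn : ∀ x, ‖((μ x : ℂˣ) : ℂ)‖ = 1) (hμc : Continuous fun x => ((μ x : ℂˣ) : ℂ))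
  (hμF : ∀ a : (v.adicCompletion (maximalRealSubfield L))ˣ,
    μ (Units.map (algebraMap (v.adicCompletion (maximalRealSubfield L)) (LocalRing L v)).toMonoidHom a) = 1 ↔
      ∃ x : (LocalRing L v)ˣ, (x : LocalRing L v) * conjLocal L (IsCMField.complexConj L) v x =
        algebraMap (v.adicCompletion (maximalRealSubfield L)) (LocalRing L v) a)
  [MeasurableSpace (v.adicCompletion (maximalRealSubfield L))] [BorelSpace (v.adicCompletion (maximalRealSubfield L))]
  (μ' : Measure (v.adicCompletion (maximalRealSubfield L))) [μ'.IsAddHaarMeasure]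

include hJ₁ in
/-- **At EVERY finite place, the reading of [Liu2021, App. D Lem. D.1, first sentence + (1)] AS PRINTED over all Step-3
characters at the tree's CM family of local splittings `finLocalSplittingsCM` (unitary splitting character `χ`) equals
the reading at ANY family `𝓢'` whose local Weil representation at `v` is `L²`-isometric** (rank `n ≠ 2`; `μ'` any Haar
measure on `L⁺_v`).  Ingredients: `LemD1OfPlace.forall_lemD1_1AsPrinted_iff_of_isL2Isometric` and
`FinLocalSplittings.isL2Isometric_omegaLoc_finLocalSplittingsCM`. [cite: Liu2021, App. D Lemma D.1 (l. 5227–5229)]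
[cite: GelbartRogawski1991, §3.1 Remark p. 457 L4–13] [cite: Weil1964, Chap. I n° 13] -/
theorem forall_lemD1_1AsPrinted_iff_finLocalSplittingsCM (hχu : χ.IsUnitary) (hn2 : n ≠ 2)
    (𝓢' : FinLocalSplittings (maximalRealSubfield L) L (IsCMField.complexConj L) n (complexConj_imagUnit L)
      (imagUnit_ne_zero L) (imagUnit_mul_self L) T₀ hT₀ hJ)
    (h𝓢' : (𝓢'.omegaLoc v).IsL2Isometric (Measure.pi fun _ : Fin n => μ')) :
    (∀ (χ' : localPi L (IsCMField.complexConj L) 1 J₁ v →* ℂˣ) (hχn : ∀ h, ‖((χ' h : ℂˣ) : ℂ)‖ = 1)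
        (hχc : Continuous fun h => ((χ' h : ℂˣ) : ℂ)),
        LemD1_1AsPrinted (data L v (IsCMField.complexConj L) n J (complexConj_imagUnit L) (imagUnit_ne_zero L) hN hJh
          hJdet J₁ ((finLocalSplittingsCM L n hT₀ hT₀d hJ χ hχ).omegaLoc v) μ hμn hμc hμF χ' hχn hχc)) ↔
      (∀ (χ' : localPi L (IsCMField.complexConj L) 1 J₁ v →* ℂˣ) (hχn : ∀ h, ‖((χ' h : ℂˣ) : ℂ)‖ = 1)
        (hχc : Continuous fun h => ((χ' h : ℂˣ) : ℂ)),
        LemD1_1AsPrinted (data L v (IsCMField.complexConj L) n J (complexConj_imagUnit L) (imagUnit_ne_zero L) hN hJh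
          hJdet J₁ (𝓢'.omegaLoc v) μ hμn hμc hμF χ' hχn hχc)) := by
  haveI := secondCountableTopology_adicCompletion (maximalRealSubfield L) v
  exact forall_lemD1_1AsPrinted_iff_of_isL2Isometric L v (IsCMField.complexConj L) n J (complexConj_imagUnit L)
    (imagUnit_ne_zero L) hN hJh hJdet J₁ hJ₁ μ hμn hμc hμF (Measure.pi fun _ : Fin n => μ') hn2 hT₀d
    (finLocalSplittingsCM L n hT₀ hT₀d hJ χ hχ) 𝓢'
    (FinLocalSplittings.isL2Isometric_omegaLoc_finLocalSplittingsCM L n hT₀ hT₀d hJ χ hχ v hχu μ') h𝓢'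

end Literature.NumberTheory.Automorphic.Liu2021.LemD1OfPlace

end
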